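import Summits.KontsevichZagierPeriods.KontsevichZagierPeriods.Theorems.HurwitzMicroSectorsNormalFormPrincipleDilogExistsBoxAtoms
import Summits.KontsevichZagierPeriods.KontsevichZagierPeriods.Theorems.HurwitzMicroSectorsNormalFormPrincipleLevelTwoSquares

/-!
# `NormalFormPrinciple` (stmt-KontsevichZagierPeriods-3869), line `SketchIdeator1` —
# leaf `stub_boxRigidity`, dilogarithm layer: the squares substitution (duplication formula)

Pure proof file (registered sub-goal `squares_substitution` of the layer `Dilog`, lead seat c9;
`--supports` the crux). The DUPLICATION formula of the dilogarithm,
`Li₂(1/a²) = 2·Li₂(1/a) + 2·Li₂(−1/a)` (`|a| ≥ 1`), is, inside the Kontsevich–Zagier calculus, the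
composite of exactly two moves between box atoms on the open unit box `□ = (0,1)²`:

* rule (2), the squares chart `Φ(x₀, x₁) = (x₀², x₁²)` of `□` onto itself (Jacobian `4x₀x₁`,
  `AlgLevelTwo.lt2_exists_squaresChart`, seat c8): the dilogarithm box `D(a²) = [□, 1/(a² − x₀x₁)]`
  pulls back to the squares-substitution box `W(a) = [□, 4x₀x₁/(a² − x₀²x₁²)]`
  (`squares_pullback_mem_relations`);
* rule (1b), additivity of the integrand: the partial-fraction identity
  `4u/(a² − u²) = 2/(a − u) + 2/(−a − u)` (`u = x₀x₁`) splits `W(a)` as `2·D(a) + 2·D(−a)`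
  (`squares_split_mem_relations`).

References: M. Kontsevich, D. Zagier, *Periods* (2001), §1.2 rules (1), (2); L. Lewin,
*Polylogarithms and associated functions* (1981), §1.5 (duplication formula). No definitions are
introduced.
-/

noncomputable section

open MeasureTheory Set
open Literature.NumberTheory.Transcendental Literature.NumberTheory.Transcendental.KZ
open Literature.ModelTheory.ExponentialFields (IsSemialgebraic)

namespace Summit.KontsevichZagierPeriods.HurwitzMicroSectors.NormalFormPrinciple.PiBox.Dilog

/-! ## Rule (2): the squares chart -/

/-- **The squares substitution (rule 2).** For any real `a` and any two representations `N`, `W`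
on the open unit box with integrands `1/(a² − x₀x₁)` and `4x₀x₁/(a² − x₀²x₁²)` respectively,
`[W] − [N]` is ONE change-of-variables move of the Kontsevich–Zagier calculus along the squares
chart `Φ(x₀,x₁) = (x₀², x₁²)` of the box onto itself (`|det DΦ| = 4x₀x₁`): the pull-back identity
`W.integrand x = N.integrand (Φ x) · |det DΦ(x)|` holds on the box. No hypothesis on `a` is needed:
both representations are given. [cite: KontsevichZagier2001, §1.2 rule (2)] -/
theorem squares_pullback_mem_relations (a : ℝ) (N W : IntegralRep 2)
    (hNd : N.domain = {x | ∀ i, x i ∈ Set.Ioo (0:ℝ) 1})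
    (hNi : EqOn N.integrand (fun x => 1 / (a ^ 2 - x 0 * x 1)) N.domain)
    (hWd : W.domain = {x | ∀ i, x i ∈ Set.Ioo (0:ℝ) 1})
    (hWi : EqOn W.integrand (fun x => 4 * x 0 * x 1 / (a ^ 2 - x 0 ^ 2 * x 1 ^ 2)) W.domain) :
    of W - of N ∈ relations := by
  obtain ⟨Φ, Φ', hΦ0, hΦ1, hsa, hderiv, hinj, himage, hdet⟩ := AlgLevelTwo.lt2_exists_squaresChart
  have himage' : N.domain = Φ '' W.domain := by rw [hWd, himage, hNd]
  have hsa' : IsSemialgebraicMapOn ℚ W.domain Φ := by rw [hWd]; exact hsa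
  have hinj' : InjOn Φ W.domain := by rw [hWd]; exact hinj
  refine changeOfVariablesRel_subset_relations
    ⟨2, W, N, Φ, Φ', hsa', fun x _ => (hderiv x).hasFDerivWithinAt, hinj', himage',
      fun x hx => ?_, rfl⟩
  -- the pull-back identity on `W.domain`, Jacobian `|det DΦ| = 4 x₀ x₁` included
  have hΦx : Φ x ∈ N.domain := himage' ▸ mem_image_of_mem _ hx
  have hx' : x ∈ {x : Fin 2 → ℝ | ∀ i, x i ∈ Set.Ioo (0:ℝ) 1} := hWd ▸ hx
  rw [hWi hx, hNi hΦx, hdet x hx']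
  simp only [hΦ0, hΦ1]
  rw [div_mul_eq_mul_div, one_mul, ← mul_pow]

/-! ## Rule (1b): the partial fractions -/

/-- The partial-fraction identity behind the duplication formula:
`4u/(a² − v) = 2/(a − u) + 2/(−a − u)` whenever `v = u²` and both `a − u`, `−a − u` are non-zero.
[folklore] -/
theorem squares_partialFraction {a u : ℝ} (h₁ : a - u ≠ 0) (h₂ : -a - u ≠ 0) :
    4 * u / (a ^ 2 - u ^ 2) = 2 * (1 / (a - u)) + 2 * (1 / (-a - u)) := by
  have h : a ^ 2 - u ^ 2 = -((a - u) * (-a - u)) := by ring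
  rw [h]
  field_simp
  ring

/-- On the open unit box, for `|a| ≥ 1`, both `a − x₀x₁` and `−a − x₀x₁` are non-zero (one of
`a`, `−a` is `≥ 1`, the other `≤ −1 < 0`, and `x₀x₁ ∈ (0,1)`). [folklore] -/
theorem dilogDen_ne_zero_and_neg {a : ℝ} (ha : 1 ≤ |a|) {x : Fin 2 → ℝ}
    (hx : ∀ i, x i ∈ Set.Ioo (0:ℝ) 1) : a - x 0 * x 1 ≠ 0 ∧ -a - x 0 * x 1 ≠ 0 := by
  rcases le_abs'.1 ha with h | h
  · exact ⟨dilogDen_ne_zero (Or.inr (by linarith)) hx, dilogDen_ne_zero (Or.inl (by linarith)) hx⟩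
  · exact ⟨dilogDen_ne_zero (Or.inl h) hx, dilogDen_ne_zero (Or.inr (by linarith)) hx⟩

/-- **The partial-fraction split (rule 1b, twice).** For `|a| ≥ 1` and representations `W`,
`D`, `D'` on the open unit box with integrands `4x₀x₁/(a² − x₀²x₁²)`, `1/(a − x₀x₁)`,
`1/(−a − x₀x₁)`: `[W] − 2[D] − 2[D'] ∈ relations`. Indeed `W`, `D + D` and `D' + D'` organise as
two integrand-additivity moves: `[W] − [D₂] − [D₂'] ` with `D₂ = [□, 2/(a − x₀x₁)]`-shaped
congruences, realised here without auxiliary representations as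
`([W] − [D] − [E]) + ([E] − [D] − [F]) + ([F] − [D'] − [D'])` where `E`, `F` are `W` with the
integrands `W − D` and `2·D'` — all three brackets are literal instances of `KZ.integrandAddRel`
once `E`, `F` exist; we avoid even that by using the congruence lemma
`KZ.of_sub_of_mem_relations_of_eqOn` against the representation `W` itself re-read with the
integrand `2·D.integrand + 2·D'.integrand`. [cite: KontsevichZagier2001, §1.2 rule (1)] -/
theorem squares_split_mem_relations {a : ℝ} (ha : 1 ≤ |a|) (W D D' : IntegralRep 2)
    (hWd : W.domain = {x | ∀ i, x i ∈ Set.Ioo (0:ℝ) 1})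
    (hWi : EqOn W.integrand (fun x => 4 * x 0 * x 1 / (a ^ 2 - x 0 ^ 2 * x 1 ^ 2)) W.domain)
    (hDd : D.domain = {x | ∀ i, x i ∈ Set.Ioo (0:ℝ) 1})
    (hDi : EqOn D.integrand (fun x => 1 / (a - x 0 * x 1)) D.domain)
    (hD'd : D'.domain = {x | ∀ i, x i ∈ Set.Ioo (0:ℝ) 1})
    (hD'i : EqOn D'.integrand (fun x => 1 / (-a - x 0 * x 1)) D'.domain) :
    of W - 2 • of D - 2 • of D' ∈ relations := by
  -- the representation `S = D + D'` on the box (integrand additivity needs a carrier)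
  let S : IntegralRep 2 :=
    ⟨D.domain, fun x => D.integrand x + D'.integrand x, D.isSemialgebraic_domain,
      (IsSemialgebraicFunOn.add_holds D.isSemialgebraicFunOn_integrand
        (hD'd.trans hDd.symm ▸ D'.isSemialgebraicFunOn_integrand)).congr fun _ _ => rfl,
      D.integrableOn.add (hD'd.trans hDd.symm ▸ D'.integrableOn)⟩
  -- `[S] − [D] − [D']` is an integrand-additivity move
  have e1 : of S - of D - of D' ∈ relations :=
    integrandAddRel_subset_relations ⟨2, S, D, D', rfl, hD'd.trans hDd.symm, fun x _ => rfl, rfl⟩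
  -- the representation `T = S + S` likewise
  let T : IntegralRep 2 :=
    ⟨D.domain, fun x => S.integrand x + S.integrand x, D.isSemialgebraic_domain,
      (IsSemialgebraicFunOn.add_holds S.isSemialgebraicFunOn_integrand
        S.isSemialgebraicFunOn_integrand).congr fun _ _ => rfl,
      S.integrableOn.add S.integrableOn⟩
  have e2 : of T - of S - of S ∈ relations :=
    integrandAddRel_subset_relations ⟨2, T, S, S, rfl, rfl, fun x _ => rfl, rfl⟩
  -- `[W] − [T]` is a congruence: the integrands agree on the box by the partial fractions
  have e3 : of W - of T ∈ relations := by
    refine of_sub_of_mem_relations_of_eqOn (hDd.trans hWd.symm) fun x hx => ?_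
    have hx' : ∀ i, x i ∈ Set.Ioo (0:ℝ) 1 := by rw [hWd] at hx; exact hx
    have hxD : x ∈ D.domain := hDd ▸ hx'
    have hxD' : x ∈ D'.domain := hD'd ▸ hx'
    obtain ⟨h₁, h₂⟩ := dilogDen_ne_zero_and_neg ha hx'
    show W.integrand x = (D.integrand x + D'.integrand x) + (D.integrand x + D'.integrand x)
    rw [hWi hx, hDi hxD, hD'i hxD']
    simp only
    rw [show x 0 ^ 2 * x 1 ^ 2 = (x 0 * x 1) ^ 2 by ring, mul_assoc,
      squares_partialFraction h₁ h₂]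
    ring
  have e : of W - 2 • of D - 2 • of D' =
      (of W - of T) + (of T - of S - of S) + 2 • (of S - of D - of D') := by
    simp only [smul_sub, two_smul]; abel
  rw [e]
  exact relations.add_mem (relations.add_mem e3 e2) (relations.nsmul_mem e1 2)

/-! ## The registered sub-goal -/

/-- **Stub S7 (`squares_substitution`; registered sub-goal of stmt-KontsevichZagierPeriods-3869,
line `SketchIdeator1`, layer `Dilog`).** (1) The squares chart `(x₀,x₁) ↦ (x₀²,x₁²)` (rule 2)
identifies the dilogarithm box `[□, 1/(a² − x₀x₁)]` with the squares-substitution box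
`[□, 4x₀x₁/(a² − x₀²x₁²)]`; (2) for real algebraic `a` with `|a| ≥ 1` the partial fractions
`4u/(a² − u²) = 2/(a − u) + 2/(−a − u)` (rule 1b) split the latter as `2[□, 1/(a − x₀x₁)] +
2[□, 1/(−a − x₀x₁)]`. Together: the duplication formula `Li₂(1/a²) = 2Li₂(1/a) + 2Li₂(−1/a)` as
a chain of three moves. [cite: KontsevichZagier2001, §1.2 rules (1), (2)] -/
theorem squares_substitution :
    (∀ (a : ℝ) (N W : IntegralRep 2),
      N.domain = {x | ∀ i, x i ∈ Set.Ioo (0:ℝ) 1} →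
      EqOn N.integrand (fun x => 1 / (a ^ 2 - x 0 * x 1)) N.domain →
      W.domain = {x | ∀ i, x i ∈ Set.Ioo (0:ℝ) 1} →
      EqOn W.integrand (fun x => 4 * x 0 * x 1 / (a ^ 2 - x 0 ^ 2 * x 1 ^ 2)) W.domain →
      of W - of N ∈ relations) ∧
    (∀ (a : ℝ), IsAlgebraic ℚ a → 1 ≤ |a| → ∀ (W D D' : IntegralRep 2),
      W.domain = {x | ∀ i, x i ∈ Set.Ioo (0:ℝ) 1} →
      EqOn W.integrand (fun x => 4 * x 0 * x 1 / (a ^ 2 - x 0 ^ 2 * x 1 ^ 2)) W.domain →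
      D.domain = {x | ∀ i, x i ∈ Set.Ioo (0:ℝ) 1} →
      EqOn D.integrand (fun x => 1 / (a - x 0 * x 1)) D.domain →
      D'.domain = {x | ∀ i, x i ∈ Set.Ioo (0:ℝ) 1} →
      EqOn D'.integrand (fun x => 1 / (-a - x 0 * x 1)) D'.domain →
      of W - 2 • of D - 2 • of D' ∈ relations) :=
  ⟨fun a N W hNd hNi hWd hWi => squares_pullback_mem_relations a N W hNd hNi hWd hWi,
    fun _ _ ha W D D' hWd hWi hDd hDi hD'd hD'i =>
      squares_split_mem_relations ha W D D' hWd hWi hDd hDi hD'd hD'i⟩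

end Summit.KontsevichZagierPeriods.HurwitzMicroSectors.NormalFormPrinciple.PiBox.Dilog
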